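import Summits.Ventures.Crystal3D.Theorems.StickyWulffConstantStackingLiminfLayerChainV4Defs
import Summits.Ventures.Crystal3D.Theorems.StickyWulffConstantStackingLiminfMollifierSmooth
import HarnessLib

/-!
# Plateau height for line `LayerChain` v4 (crux `StackingLiminf`, stmt-Ventures-19145), part 1:
# the clipped radial profile of the mollifier `bump K`, its cell MAJORANT, and their integrals

Route `StickyWulffConstant` of the venture `Summits/Ventures/Crystal3D` (cell `crystal3d-full`).
(`bumpConst_pos`, `dot3_self_nonneg`, `continuous_bump`, `bump_nonneg` are wulff-p2's, imported from
`…StackingLiminfMollifierSmooth`, p506750.)  Toolkit for the plateau-height bound `dens x K ≤ √2 ∫ φ_K + C/K` (rung R6 / stub (C) of the line,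
planner cf-p1 g13; objects `bump`, `bumpConst`, `dens` of `…LayerChainV4Defs`, p505287):
* the profile `G ρ = (1 − (ρ₊)²)₊³`: antitone, `6`-Lipschitz (`profile_sub_le`), vanishing beyond `1`;
* Euclidean length on `Fin 3 → ℝ` through `dot3` (`√(v·v) = ‖toLp 2 v‖`, reverse triangle
  inequality, domination of the sup norm);
* `bump K u = c_K G(|u|/K)` (`bump_eq_profile`), the POINTWISE MAJORANT
  `φ_K(y − p) ≤ c_K G((|q − y| − 2)/K)` for every `q` within Euclidean distance `2` of `p`
  (`bump_le_majorant`), and the Lipschitz comparison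
  `c_K G((|q| − 2)/K) − φ_K(q) ≤ (12 c_K/K)·1_{B̄_∞(0,K+2)}(q)` (`majorant_sub_bump_le`);
* continuity / compact support / integrability of bump and majorant, and
  `∫ c_K G((|q| − 2)/K) dq ≤ ∫ φ_K + 12 c_K (2(K+2))³/K` (`integral_majorant_le`).
WHAT THIS IS NOT: no stub of the line; nothing about Barlow stackings yet (part 2: cells; part 3: the
density bound); rung F-C1 not moved.
-/

noncomputable section

namespace Summit.Ventures.Crystal3D.Theorems.PlateauHeight

open MeasureTheory Set Metric
open Literature.MathematicalPhysics.StatisticalMechanics (barlowPos barlowStacking haggLabel)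
open Summit.Ventures.Crystal3D.Cruxes.StackingLiminf.LayerChainV4 (bump bumpConst dens)
open Summit.Ventures.Crystal3D.LayerChain (dot3)

/-! ### The clipped radial profile `G ρ = (1 − (ρ₊)²)₊³` -/

/-- `G` is antitone: `ρ ≤ ρ'` ⇒ `G ρ' ≤ G ρ`. -/
theorem profile_antitone {ρ ρ' : ℝ} (h : ρ ≤ ρ') :
    (max 0 (1 - (max 0 ρ') ^ 2)) ^ 3 ≤ (max 0 (1 - (max 0 ρ) ^ 2)) ^ 3 := by
  have hm : max 0 ρ ≤ max 0 ρ' := max_le_max le_rfl h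
  have hm0 : 0 ≤ max 0 ρ := le_max_left _ _
  have h1 : 1 - (max 0 ρ') ^ 2 ≤ 1 - (max 0 ρ) ^ 2 := by nlinarith
  have h2 : max 0 (1 - (max 0 ρ') ^ 2) ≤ max 0 (1 - (max 0 ρ) ^ 2) := max_le_max le_rfl h1
  exact pow_le_pow_left₀ (le_max_left _ _) h2 3

/-- `G` is `6`-Lipschitz (one-sided form): `ρ ≤ ρ'` ⇒ `G ρ − G ρ' ≤ 6 (ρ' − ρ)`. -/
theorem profile_sub_le {ρ ρ' : ℝ} (h : ρ ≤ ρ') :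
    (max 0 (1 - (max 0 ρ) ^ 2)) ^ 3 - (max 0 (1 - (max 0 ρ') ^ 2)) ^ 3 ≤ 6 * (ρ' - ρ) := by
  set m := max 0 ρ with hm
  set m' := max 0 ρ' with hm'
  have hmm : m ≤ m' := max_le_max le_rfl h
  have hm0 : 0 ≤ m := le_max_left _ _
  have hdm : m' - m ≤ ρ' - ρ := by
    rcases le_total 0 ρ with hρ | hρ
    · rw [hm, hm', max_eq_right hρ, max_eq_right (hρ.trans h)]
    · rw [hm, max_eq_left hρ]
      rcases le_total 0 ρ' with hρ' | hρ'
      · rw [hm', max_eq_right hρ']; linarith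
      · rw [hm', max_eq_left hρ']; linarith
  set A := max 0 (1 - m ^ 2) with hA
  set B := max 0 (1 - m' ^ 2) with hB
  have hB0 : 0 ≤ B := le_max_left _ _
  have hBA : B ≤ A := max_le_max le_rfl (by nlinarith)
  have hA1 : A ≤ 1 := max_le zero_le_one (by nlinarith)
  -- `A − B ≤ 2 (m' − m)`
  have hAB : A - B ≤ 2 * (m' - m) := by
    rcases le_or_gt 1 m' with h1 | h1
    · -- `B = 0`, `A ≤ 1 − m² ≤ 2 (1 − m) ≤ 2 (m' − m)` (or `A = 0`)
      have hB' : B = 0 := by rw [hB]; exact max_eq_left (by nlinarith)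
      rw [hB', sub_zero]
      rcases le_or_gt 1 m with h2 | h2
      · have : A = 0 := by rw [hA]; exact max_eq_left (by nlinarith)
        rw [this]; linarith
      · have : A ≤ 1 - m ^ 2 := max_le (by nlinarith) le_rfl
        nlinarith
    · -- `m' < 1`: `A = 1 − m²`, `B = 1 − m'²`
      have hA' : A = 1 - m ^ 2 := by rw [hA]; exact max_eq_right (by nlinarith)
      have hB' : B = 1 - m' ^ 2 := by rw [hB]; exact max_eq_right (by nlinarith)
      rw [hA', hB']
      nlinarith
  have key : A ^ 3 - B ^ 3 = (A - B) * (A ^ 2 + A * B + B ^ 2) := by ring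
  rw [key]
  have h3 : A ^ 2 + A * B + B ^ 2 ≤ 3 := by nlinarith
  have h4 : 0 ≤ A - B := by linarith
  nlinarith

/-- Beyond the cut-off the profile vanishes: `1 < ρ ⇒ G ρ = 0`. -/
theorem profile_eq_zero {ρ : ℝ} (h : 1 < ρ) : (max 0 (1 - (max 0 ρ) ^ 2)) ^ 3 = 0 := by
  have : max 0 ρ = ρ := max_eq_right (by linarith)
  rw [this, max_eq_left (by nlinarith)]
  ring

/-- The profile is at most `1`. -/
theorem profile_le_one (ρ : ℝ) : (max 0 (1 - (max 0 ρ) ^ 2)) ^ 3 ≤ 1 := by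
  have h1 : max 0 (1 - (max 0 ρ) ^ 2) ≤ 1 := max_le zero_le_one (by nlinarith [sq_nonneg (max 0 ρ)])
  have h0 : 0 ≤ max 0 (1 - (max 0 ρ) ^ 2) := le_max_left _ _
  calc (max 0 (1 - (max 0 ρ) ^ 2)) ^ 3 ≤ 1 ^ 3 := pow_le_pow_left₀ h0 h1 3
    _ = 1 := one_pow 3

/-- The profile is nonnegative. -/
theorem profile_nonneg (ρ : ℝ) : 0 ≤ (max 0 (1 - (max 0 ρ) ^ 2)) ^ 3 :=
  pow_nonneg (le_max_left _ _) 3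

/-! ### Euclidean length on `Fin 3 → ℝ` via `dot3` -/

/-- `dot3 v v = ‖toLp 2 v‖²` (Euclidean norm). -/
theorem dot3_self_eq_norm_sq (v : Fin 3 → ℝ) :
    dot3 v v = ‖(WithLp.toLp 2 v : EuclideanSpace ℝ (Fin 3))‖ ^ 2 := by
  rw [EuclideanSpace.real_norm_sq_eq, Fin.sum_univ_three]
  simp [dot3, sq]

/-- `√(dot3 v v) = ‖toLp 2 v‖`. -/
theorem sqrt_dot3_self (v : Fin 3 → ℝ) :
    Real.sqrt (dot3 v v) = ‖(WithLp.toLp 2 v : EuclideanSpace ℝ (Fin 3))‖ := by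
  rw [dot3_self_eq_norm_sq, Real.sqrt_sq (norm_nonneg _)]

/-- Each coordinate is bounded by the Euclidean length. -/
theorem abs_apply_le_sqrt_dot3 (v : Fin 3 → ℝ) (j : Fin 3) : |v j| ≤ Real.sqrt (dot3 v v) := by
  rw [← Real.sqrt_sq_eq_abs]
  apply Real.sqrt_le_sqrt
  have h0 := sq_nonneg (v 0); have h1 := sq_nonneg (v 1); have h2 := sq_nonneg (v 2)
  fin_cases j <;> simp [dot3] <;> nlinarith

/-- The sup norm is bounded by the Euclidean length. -/
theorem norm_le_sqrt_dot3 (v : Fin 3 → ℝ) : ‖v‖ ≤ Real.sqrt (dot3 v v) := by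
  rw [pi_norm_le_iff_of_nonneg (Real.sqrt_nonneg _)]
  intro j
  rw [Real.norm_eq_abs]
  exact abs_apply_le_sqrt_dot3 v j

/-- Reverse triangle inequality for the Euclidean length on `Fin 3 → ℝ`:
`√((a+b)·(a+b)) ≥ √(a·a) − √(b·b)`. -/
theorem sqrt_dot3_add_ge (a b : Fin 3 → ℝ) :
    Real.sqrt (dot3 a a) - Real.sqrt (dot3 b b) ≤ Real.sqrt (dot3 (a + b) (a + b)) := by
  rw [sqrt_dot3_self, sqrt_dot3_self, sqrt_dot3_self, WithLp.toLp_add]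
  have := norm_sub_le_norm_add (WithLp.toLp 2 a : EuclideanSpace ℝ (Fin 3)) (WithLp.toLp 2 b)
  linarith [norm_le_add_norm_add (WithLp.toLp 2 a : EuclideanSpace ℝ (Fin 3)) (WithLp.toLp 2 b)]

/-! ### The bump as a clipped radial profile, and its majorant -/

/-- `bump K u = c_K · G(|u|/K)`. -/
theorem bump_eq_profile {K : ℝ} (hK : 0 < K) (u : Fin 3 → ℝ) :
    bump K u = bumpConst / K ^ 3 *
      (max 0 (1 - (max 0 (Real.sqrt (dot3 u u) / K)) ^ 2)) ^ 3 := by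
  unfold bump
  congr 2
  have h0 : 0 ≤ Real.sqrt (dot3 u u) / K := div_nonneg (Real.sqrt_nonneg _) hK.le
  rw [max_eq_right h0, div_pow, Real.sq_sqrt (dot3_self_nonneg u)]

/-- **Pointwise majorant.**  If `q` is within Euclidean distance `2` of the centre `p` then
`φ_K(y − p) ≤ c_K · G((|q − y| − 2)/K)`. -/
theorem bump_le_majorant {K : ℝ} (hK : 0 < K) (y p q : Fin 3 → ℝ)
    (hq : Real.sqrt (dot3 (q - p) (q - p)) ≤ 2) :
    bump K (fun j => y j - p j) ≤ bumpConst / K ^ 3 *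
      (max 0 (1 - (max 0 ((Real.sqrt (dot3 (q - y) (q - y)) - 2) / K)) ^ 2)) ^ 3 := by
  rw [bump_eq_profile hK]
  refine mul_le_mul_of_nonneg_left (profile_antitone ?_) (div_nonneg bumpConst_pos.le (pow_nonneg hK.le 3))
  -- `(|q−y| − 2)/K ≤ |y−p|/K`
  apply div_le_div_of_nonneg_right _ hK.le
  have h1 := sqrt_dot3_add_ge (y - q) (q - p)
  have e1 : (y - q) + (q - p) = (fun j => y j - p j) := by
    ext j; simp only [Pi.add_apply, Pi.sub_apply]; ring
  have e2 : dot3 (y - q) (y - q) = dot3 (q - y) (q - y) := by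
    simp only [dot3, Pi.sub_apply]; ring
  rw [e1, e2] at h1
  linarith

/-- **Comparison of the majorant with the bump at the same point** (Lipschitz bound):
`c_K G((|q| − 2)/K) − φ_K(q) ≤ (12 c_K / K) · 1_{B̄_∞(0, K+2)}(q)`. -/
theorem majorant_sub_bump_le {K : ℝ} (hK : 0 < K) (q : Fin 3 → ℝ) :
    bumpConst / K ^ 3 * (max 0 (1 - (max 0 ((Real.sqrt (dot3 q q) - 2) / K)) ^ 2)) ^ 3 - bump K q ≤
      (closedBall (0 : Fin 3 → ℝ) (K + 2)).indicator (fun _ => 12 * bumpConst / K ^ 4) q := by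
  have hc : 0 ≤ bumpConst / K ^ 3 := div_nonneg bumpConst_pos.le (pow_nonneg hK.le 3)
  rw [bump_eq_profile hK]
  by_cases hq : q ∈ closedBall (0 : Fin 3 → ℝ) (K + 2)
  · rw [indicator_of_mem hq, ← mul_sub]
    have h := profile_sub_le (show (Real.sqrt (dot3 q q) - 2) / K ≤ Real.sqrt (dot3 q q) / K from
      div_le_div_of_nonneg_right (by linarith) hK.le)
    have e : Real.sqrt (dot3 q q) / K - (Real.sqrt (dot3 q q) - 2) / K = 2 / K := by
      field_simp; ring
    rw [e] at h
    calc bumpConst / K ^ 3 * ((max 0 (1 - max 0 ((Real.sqrt (dot3 q q) - 2) / K) ^ 2)) ^ 3 -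
          (max 0 (1 - max 0 (Real.sqrt (dot3 q q) / K) ^ 2)) ^ 3)
        ≤ bumpConst / K ^ 3 * (6 * (2 / K)) := mul_le_mul_of_nonneg_left h hc
      _ = 12 * bumpConst / K ^ 4 := by field_simp; ring
  · rw [indicator_of_notMem hq]
    -- outside the sup-ball both profiles vanish
    have hq' : K + 2 < ‖q‖ := by rwa [mem_closedBall, dist_zero_right, not_le] at hq
    have hr : K + 2 < Real.sqrt (dot3 q q) := lt_of_lt_of_le hq' (norm_le_sqrt_dot3 q)
    have h1 : 1 < (Real.sqrt (dot3 q q) - 2) / K := by rw [lt_div_iff₀ hK]; linarith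
    have h2 : 1 < Real.sqrt (dot3 q q) / K := by rw [lt_div_iff₀ hK]; linarith
    rw [profile_eq_zero h1, profile_eq_zero h2]
    simp


/-! ### Integrability of the bump and of its majorant -/

/-- The bump vanishes outside the sup-norm ball of radius `K`. -/
theorem bump_eq_zero_of_norm {K : ℝ} (hK : 0 < K) {u : Fin 3 → ℝ} (hu : K < ‖u‖) : bump K u = 0 := by
  rw [bump_eq_profile hK]
  have h1 : 1 < Real.sqrt (dot3 u u) / K := by
    rw [lt_div_iff₀ hK]; linarith [norm_le_sqrt_dot3 u]
  rw [profile_eq_zero h1, mul_zero]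

/-- The bump is integrable (`K > 0`). -/
theorem integrable_bump {K : ℝ} (hK : 0 < K) : Integrable (bump K) := by
  refine (continuous_bump K).integrable_of_hasCompactSupport ?_
  refine HasCompactSupport.intro (isCompact_closedBall (0 : Fin 3 → ℝ) K) fun u hu => ?_
  rw [mem_closedBall, dist_zero_right, not_le] at hu
  exact bump_eq_zero_of_norm hK hu

/-- The translated majorant `q ↦ c_K G((|q − y| − 2)/K)` is continuous. -/
theorem continuous_majorant (K : ℝ) (y : Fin 3 → ℝ) :
    Continuous fun q : Fin 3 → ℝ =>
      bumpConst / K ^ 3 * (max 0 (1 - (max 0 ((Real.sqrt (dot3 (q - y) (q - y)) - 2) / K)) ^ 2)) ^ 3 := by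
  unfold dot3
  fun_prop

/-- The translated majorant vanishes outside the sup-norm ball `B̄(y, K + 2)`. -/
theorem majorant_eq_zero_of_norm {K : ℝ} (hK : 0 < K) (y : Fin 3 → ℝ) {q : Fin 3 → ℝ}
    (hq : K + 2 < ‖q - y‖) :
    bumpConst / K ^ 3 *
      (max 0 (1 - (max 0 ((Real.sqrt (dot3 (q - y) (q - y)) - 2) / K)) ^ 2)) ^ 3 = 0 := by
  have h1 : 1 < (Real.sqrt (dot3 (q - y) (q - y)) - 2) / K := by
    rw [lt_div_iff₀ hK]; linarith [norm_le_sqrt_dot3 (q - y)]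
  rw [profile_eq_zero h1, mul_zero]

/-- The translated majorant is integrable (`K > 0`). -/
theorem integrable_majorant {K : ℝ} (hK : 0 < K) (y : Fin 3 → ℝ) :
    Integrable fun q : Fin 3 → ℝ =>
      bumpConst / K ^ 3 * (max 0 (1 - (max 0 ((Real.sqrt (dot3 (q - y) (q - y)) - 2) / K)) ^ 2)) ^ 3 := by
  refine (continuous_majorant K y).integrable_of_hasCompactSupport ?_
  refine HasCompactSupport.intro (isCompact_closedBall y (K + 2)) fun q hq => ?_
  rw [mem_closedBall, dist_eq_norm, not_le] at hq
  exact majorant_eq_zero_of_norm hK y hq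

/-- The (untranslated) majorant integrates to at most `∫ φ_K + 12 c_K (2(K+2))³ / K`. -/
theorem integral_majorant_le {K : ℝ} (hK : 0 < K) :
    ∫ q : Fin 3 → ℝ, bumpConst / K ^ 3 *
        (max 0 (1 - (max 0 ((Real.sqrt (dot3 q q) - 2) / K)) ^ 2)) ^ 3 ≤
      (∫ u, bump K u) + 12 * bumpConst / K ^ 4 * (2 * (K + 2)) ^ 3 := by
  have hint0 : Integrable fun q : Fin 3 → ℝ => bumpConst / K ^ 3 *
      (max 0 (1 - (max 0 ((Real.sqrt (dot3 q q) - 2) / K)) ^ 2)) ^ 3 := by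
    have := integrable_majorant hK 0
    simpa using this
  have hind : Integrable fun q : Fin 3 → ℝ =>
      (closedBall (0 : Fin 3 → ℝ) (K + 2)).indicator (fun _ => 12 * bumpConst / K ^ 4) q :=
    (integrable_indicator_iff measurableSet_closedBall).2
      ((integrableOn_const_iff).2 (Or.inr measure_closedBall_lt_top))
  calc ∫ q : Fin 3 → ℝ, bumpConst / K ^ 3 *
        (max 0 (1 - (max 0 ((Real.sqrt (dot3 q q) - 2) / K)) ^ 2)) ^ 3
      ≤ ∫ q : Fin 3 → ℝ, (bump K q +
          (closedBall (0 : Fin 3 → ℝ) (K + 2)).indicator (fun _ => 12 * bumpConst / K ^ 4) q) :=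
        integral_mono hint0 ((integrable_bump hK).add hind) fun q => by
          have := majorant_sub_bump_le hK q
          simp only at this ⊢
          linarith
    _ = (∫ u, bump K u) +
          ∫ q : Fin 3 → ℝ, (closedBall (0 : Fin 3 → ℝ) (K + 2)).indicator
            (fun _ => 12 * bumpConst / K ^ 4) q := integral_add (integrable_bump hK) hind
    _ = (∫ u, bump K u) + 12 * bumpConst / K ^ 4 * (2 * (K + 2)) ^ 3 := by
        rw [integral_indicator_const _ measurableSet_closedBall, smul_eq_mul, measureReal_def,
          Real.volume_pi_closedBall _ (by linarith), ENNReal.toReal_ofReal (by positivity)]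
        simp [Fintype.card_fin]
        ring

end Summit.Ventures.Crystal3D.Theorems.PlateauHeight

end
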